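import Summits.NavierStokesRegularity.NavierStokesRegularity.Theorems.SymmetryModuliCountAxisymEndLiouvilleStubAxisNormalForm
import Literature.Analysis.FluidPDE.IsometryInvariance
import Literature.Analysis.FluidPDE.NewtonKernel
import Literature.Analysis.FluidPDE.SwirlTransportProofs
import HarnessLib

/-!
# `SpiralScalingLiouville` (stmt-NavierStokesRegularity-8216), line `registered` (birth skeleton,
# lead's reshape): stub `stub_profileAxisNormalForm` — axis normal form of the rotated profile system

Let `A` be a NONZERO skew linear map of `ℝ³` and `(U, P)` (`U ∈ C^∞`, `P ∈ C¹`, `div U = 0`) a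
solution of the rotated Leray profile system
`−ΔU + ½U + ½DU[y + Ay] − ½AU + DU[U] + ∇P = 0` (Pineau–Vicol 2026, (1.8) with the matrix `A` in
place of `αJ`) with the Type-I profile decay `‖U(y)‖ ≤ K/(‖y‖ + 1)`. By the tree's normal form of a
nonzero skew map of `ℝ³` (`exists_conj_eq_smul_rotGen`) there are a linear isometry `L` and
`β ≠ 0` with `L A L⁻¹ = β J`, `J = rotGen = e₃ × ·`. Put `α = −β/2 ≠ 0`, `V = L ∘ U ∘ L⁻¹`,
`Q = P ∘ L⁻¹`. Every term of the system is `L`-covariant (tree: `IsometryInvariance`), and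
`L (A U) = β J V`, `L DU[A ·] = β DV[J ·]`, so `(V, Q)` solves Pineau–Vicol's profile system (1.8a)
`α(JV − DV[Jy]) + ½V + ½DV[y] − ΔV + DV[V] + ∇Q = 0`; `V` is smooth, divergence free and keeps the
decay constant (`‖L⁻¹ y‖ = ‖y‖`). The pressure is upgraded from `C¹` to `C^∞` through the
equation: `∇P = ΔU − ½U − ½DU[y + Ay] + ½AU − DU[U]` is smooth, hence so is `DP = ⟪∇P, ·⟫`
(`contDiff_infty_iff_fderiv`), and `Q = P ∘ L⁻¹` is smooth.

## References

* B. Pineau, V. Vicol, arXiv:2607.09619 (2026), (1.7)–(1.8a), p. 3. [PineauVicol2026]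
* A. J. Majda, A. L. Bertozzi, *Vorticity and Incompressible Flow* (CUP 2002), §1.2,
  Prop. 1.1 (iii) (rotation symmetry). [MajdaBertozziCUP2002]
-/

noncomputable section

-- the summit and its single problem share the name (D-0017 nested layout)
set_option linter.dupNamespace false

open Set Function
open scoped ContDiff Laplacian RealInnerProductSpace
open Literature.Analysis.FluidPDE
open Summit.NavierStokesRegularity.NavierStokesRegularity.Theorems.AxisymEndLiouville.AbsorbingAxisSwirlExtinction

namespace Summit.NavierStokesRegularity.NavierStokesRegularity.Theorems.SpiralScalingLiouville.Birth

/-- Local notation for physical space `ℝ³`. -/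
local notation "E3" => EuclideanSpace ℝ (Fin 3)

/-- **Pressure regularity through the rotated profile system**: if `U ∈ C^∞` and `P ∈ C¹` solve
`−ΔU + ½U + ½DU[y + Ay] − ½AU + DU[U] + ∇P = 0`, then `P ∈ C^∞`, since
`∇P = ΔU − ½U − ½DU[y + Ay] + ½AU − DU[U]` is smooth and `DP = ⟪∇P, ·⟫` (Tsai 1998, p. 34:
"since `U` is smooth, `P` is also smooth"; pattern of the tree's
`IsLerayProfile.contDiff_two_pressure`). [folklore] -/
theorem contDiff_infty_pressure_of_rotatedProfileSystem {A : E3 →L[ℝ] E3} {U : E3 → E3}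
    {P : E3 → ℝ} (hU : ContDiff ℝ ∞ U) (hP : ContDiff ℝ 1 P)
    (heq : ∀ y, -((Δ U) y) + (1 / 2 : ℝ) • U y + (1 / 2 : ℝ) • fderiv ℝ U y (y + A y)
        - (1 / 2 : ℝ) • A (U y) + convect U U y + gradient P y = 0) :
    ContDiff ℝ ∞ P := by
  have hDU : ContDiff ℝ ∞ (fderiv ℝ U) := hU.fderiv_right (m := ∞) le_rfl
  -- the right-hand side `∇P = ΔU − ½U − ½DU[y + Ay] + ½AU − DU[U]` is smooth
  have hG : ContDiff ℝ ∞ fun y => (Δ U) y - (1 / 2 : ℝ) • U y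
      - (1 / 2 : ℝ) • fderiv ℝ U y (y + A y) + (1 / 2 : ℝ) • A (U y) - convect U U y := by
    have h1 : ContDiff ℝ ∞ (Δ U) := contDiff_laplacian (n := (⊤ : ℕ∞)) (by exact_mod_cast hU)
    have h2 : ContDiff ℝ ∞ fun y => (1 / 2 : ℝ) • U y := hU.const_smul (1 / 2 : ℝ)
    have h3 : ContDiff ℝ ∞ fun y => (1 / 2 : ℝ) • fderiv ℝ U y (y + A y) :=
      (hDU.clm_apply (contDiff_id.add A.contDiff)).const_smul (1 / 2 : ℝ)
    have h4 : ContDiff ℝ ∞ fun y => (1 / 2 : ℝ) • A (U y) :=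
      (A.contDiff.comp hU).const_smul (1 / 2 : ℝ)
    have h5 : ContDiff ℝ ∞ (convect U U) := by
      have h : convect U U = fun y => fderiv ℝ U y (U y) := rfl
      rw [h]
      exact hDU.clm_apply hU
    exact (((h1.sub h2).sub h3).add h4).sub h5
  have hgradP : gradient P = fun y => (Δ U) y - (1 / 2 : ℝ) • U y
      - (1 / 2 : ℝ) • fderiv ℝ U y (y + A y) + (1 / 2 : ℝ) • A (U y) - convect U U y := by
    funext y
    have hy := heq y
    rw [← sub_eq_zero, ← hy]
    abel
  have hfd : fderiv ℝ P = fun x => InnerProductSpace.toDual ℝ E3 (gradient P x) := by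
    funext x
    simp [gradient]
  rw [contDiff_infty_iff_fderiv]
  refine ⟨hP.differentiable one_ne_zero, ?_⟩
  rw [hfd, hgradP]
  exact (InnerProductSpace.toDual ℝ E3).contDiff.comp hG

/-- **Stub 2b — axis normal form of the rotated profile system.** For a NONZERO skew rate `A`,
there are a linear isometry `L` of `ℝ³` and `α ≠ 0` with `L A L⁻¹ = −2α J` (`J = rotGen = e₃ × ·`;
tree: `exists_conj_eq_smul_rotGen`), and the conjugate pair `V = L ∘ U ∘ L⁻¹`, `Q = P ∘ L⁻¹` of a
solution `(U, P)` (`U ∈ C^∞`, `P ∈ C¹`, `div U = 0`) of the rotated Leray profile system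
`−ΔU + ½U + ½DU[y + Ay] − ½AU + DU[U] + ∇P = 0` is smooth (pressure upgraded through the equation,
`contDiff_infty_pressure_of_rotatedProfileSystem`), divergence free, keeps the decay constant
`‖V(y)‖ ≤ K/(‖y‖ + 1)`, and solves Pineau–Vicol's profile system (1.8a)
`α(JV − DV[Jy]) + ½V + ½DV[y] − ΔV + DV[V] + ∇Q = 0`: every term is `L`-covariant
(`laplacian_conj_linearIsometryEquiv`, `fderiv_conj_linearIsometryEquiv`,
`gradient_comp_linearIsometryEquiv_symm`) and `L(AU) = βJV`, `L DU[AL⁻¹y] = β DV[Jy]` with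
`β = −2α`. [cite: PineauVicol2026, (1.8a) (arXiv:2607.09619 p. 3)] -/
theorem stub_profileAxisNormalForm :
    ∀ (A : E3 →L[ℝ] E3), (∀ x, inner ℝ (A x) x = 0) → A ≠ 0 →
      ∀ (U : E3 → E3) (P : E3 → ℝ), ContDiff ℝ ∞ U → ContDiff ℝ 1 P →
        VectorCalculus.IsDivFree U →
        (∀ y, -((Δ U) y) + (1 / 2 : ℝ) • U y + (1 / 2 : ℝ) • fderiv ℝ U y (y + A y)
            - (1 / 2 : ℝ) • A (U y) + convect U U y + gradient P y = 0) →
        ∀ K : ℝ, (∀ y, ‖U y‖ ≤ K / (‖y‖ + 1)) →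
        ∃ (L : E3 ≃ₗᵢ[ℝ] E3) (α : ℝ) (V : E3 → E3) (Q : E3 → ℝ), α ≠ 0 ∧ ContDiff ℝ ∞ V ∧ ContDiff ℝ ∞ Q ∧
          VectorCalculus.IsDivFree V ∧
          (∀ y, α • (rotGen (V y) - fderiv ℝ V y (rotGen y)) + (1 / 2 : ℝ) • V y + (1 / 2 : ℝ) • fderiv ℝ V y y
              - (Δ V) y + fderiv ℝ V y (V y) + gradient Q y = 0) ∧
          (∀ y, ‖V y‖ ≤ K / (‖y‖ + 1)) ∧ (∀ y, V y = L (U (L.symm y))) := by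
  intro A hA hA0 U P hU hP hdiv heq K hK
  -- normal form of the nonzero skew rate: `L A L⁻¹ = β J`, `β ≠ 0`
  obtain ⟨L, β, hβ, hLA⟩ := exists_conj_eq_smul_rotGen hA hA0
  -- the pressure is smooth (through the equation)
  have hP' : ContDiff ℝ ∞ P := contDiff_infty_pressure_of_rotatedProfileSystem hU hP heq
  -- the derivative of the conjugate field, applied
  have hD : ∀ y v : E3, fderiv ℝ (fun z => L (U (L.symm z))) y v =
      L (fderiv ℝ U (L.symm y) (L.symm v)) := fun y v => by
    rw [fderiv_conj_linearIsometryEquiv]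
    rfl
  refine ⟨L, -β / 2, fun y => L (U (L.symm y)), fun y => P (L.symm y),
    div_ne_zero (neg_ne_zero.2 hβ) two_ne_zero, ?_, ?_, hdiv.conj_linearIsometryEquiv L, ?_, ?_,
    fun y => rfl⟩
  · -- smoothness of `V = L ∘ U ∘ L⁻¹`
    exact L.toContinuousLinearEquiv.contDiff.comp (hU.comp L.symm.toContinuousLinearEquiv.contDiff)
  · -- smoothness of `Q = P ∘ L⁻¹`
    exact hP'.comp L.symm.toContinuousLinearEquiv.contDiff
  · -- Pineau–Vicol's profile system (1.8a) at `y`, from the rotated system at `x = L⁻¹ y`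
    intro y
    beta_reduce
    obtain ⟨x, hx⟩ : ∃ x : E3, L.symm y = x := ⟨_, rfl⟩
    -- `L (A U(x)) = β J V(y)`
    have h1 : L (A (U x)) = β • rotGen (L (U x)) := by
      have h := hLA (L (U x))
      rwa [LinearIsometryEquiv.symm_apply_apply] at h
    -- `β DV(y)[J y] = L DU(x)[A x]`
    have h2 : β • fderiv ℝ (fun z => L (U (L.symm z))) y (rotGen y) = L (fderiv ℝ U x (A x)) := by
      rw [← ContinuousLinearMap.map_smul, ← hLA y, hD, LinearIsometryEquiv.symm_apply_apply, hx]
    -- the remaining terms are `L`-covariant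
    have h3 : fderiv ℝ (fun z => L (U (L.symm z))) y y = L (fderiv ℝ U x x) := by
      rw [hD, hx]
    have h4 : fderiv ℝ (fun z => L (U (L.symm z))) y (L (U x)) = L (fderiv ℝ U x (U x)) := by
      rw [hD, LinearIsometryEquiv.symm_apply_apply, hx]
    have h5 : (Δ (fun z => L (U (L.symm z)))) y = L ((Δ U) x) := by
      rw [laplacian_conj_linearIsometryEquiv, hx]
    have h6 : gradient (fun z => P (L.symm z)) y = L (gradient P x) := by
      rw [gradient_comp_linearIsometryEquiv_symm, hx]
    -- the rotated system at `x`, pushed through `L`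
    have key := congrArg L (heq x)
    simp only [map_zero, map_add, map_sub, map_neg, LinearIsometryEquiv.map_smul, convect_apply] at key
    rw [hx, h3, h4, h5, h6]
    linear_combination (norm := module) (1 / 2 : ℝ) • h1 + (1 / 2 : ℝ) • h2 + key
  · -- the decay constant is kept: `‖V(y)‖ = ‖U(L⁻¹ y)‖`, `‖L⁻¹ y‖ = ‖y‖`
    intro y
    beta_reduce
    rw [LinearIsometryEquiv.norm_map, ← L.symm.norm_map y]
    exact hK (L.symm y)

end Summit.NavierStokesRegularity.NavierStokesRegularity.Theorems.SpiralScalingLiouville.Birth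

end
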